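import Summits.ResolutionOfSingularities.ResolutionOfSingularities.Theorems.PurelyInseparableDim4PureLeafNormalForms
import HarnessLib
import HarnessLib.Audit.Tags

/-!
# Purely inseparable fourfolds — TRANSITIONS of the normal forms under a SINGLETON blow-up over `𝔽₂`
# (cell res-dim4-pi; D3b, case (U1) of `HOME/res-dim4-p-10/D3b-PAPER.md` §2)
# [OURS · counted 0 · bookkeeping identities of OUR frame, not about resolution]

Width seat `res-dim4-p-10` (g2).  First half of the transition table of the paper proof «pure leaves win the global
game over `𝔽₂`»: the move (U1) — a product state `N(a,e) = ∏ xᵢ^{aᵢ}(1+xᵢ)^{eᵢ}` with `2 ≤ a_j`, the singleton centre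
`{j}`, ANY `𝔽₂`-rational reply `b` (`b_j = 0`; `bᵢ = 1` = a move along the centre off the component `xᵢ = 0`):

* `pointTransform_singleton` — the uncleaned transform is again a normal form `N(a′,e′)`: `a_j ↦ a_j − 2`, then
  `(aᵢ,eᵢ) ↦ (eᵢ,aᵢ)` at every translated `i` (`translate_prod_zmod2`);
* `step_F_of_purelyOdd` — case (α): if some factor of `N(a′,e′)` is purely odd (`a′_k` odd, `e′_k` even) the cleaning
  deletes nothing: `F′ = N(a′,e′)`;
* `sub_deletePthPowers_of_forall_even`, `step_F_of_forall_even` — case (β): if every `a′ᵢ` is even, the square part is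
  `N(a′, ê)` with `êᵢ = e′ᵢ − (e′ᵢ % 2)`, so `F′ = N(a′,e′) − N(a′,ê) = N(a′,ê) · (∏_{e′ᵢ odd} (1+xᵢ) − 1)`
  (`prod_sub_eq_mul_L`) — the birth of an L-state (`|T₁| ≥ 2`) or of a mixed variable (`|T₁| = 1`).

The pair move (U2), the L-state moves and the invariant-carrying induction are NOT in this file (plan: memo §4).
Nothing here proves resolution of singularities in dimension ≥ 4 / characteristic `p`; counted 0; AI work, weaker than
expert review. bears_on: LADDER-RESOLUTION:D157-DOOR2 (res-dim4-pi · WORD #60 D3b). Supports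
stmt-ResolutionOfSingularities-16155 (helper).
-/

set_option linter.dupNamespace false

open MvPolynomial Finset

open scoped BigOperators

noncomputable section

namespace Summit.ResolutionOfSingularities.ResolutionOfSingularities.Theorems.PIDim4

namespace PureLeafNF

open Literature.AlgebraicGeometry.Resolution
open Literature.AlgebraicGeometry.Resolution.Hauser2010
open CentreBlowup PthPowerFactor

variable {σ : Type*} [Fintype σ] [DecidableEq σ]

/-! ## 1. The uncleaned transform of a singleton move -/

/-- **(U1) The uncleaned transform is a normal form.** State with `F = N(a,e)`, `2 ≤ a_j`, reply `b` (`b_j = 0`) in the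
chart `x_j` of the centre `{x_j}`: `F⁺ = N(a′,e′)` with `a′ = swap_b (a − 2δ_j)`, `e′ = swap_b e`. [folklore] -/
theorem pointTransform_singleton (s : CState σ (ZMod 2)) (a e : σ → ℕ)
    (hF : s.F = ∏ i, X i ^ a i * (1 + X i) ^ e i) {j : σ} (hj : 2 ≤ a j) (b : σ → ZMod 2) :
    pointTransform 2 {j} j b s =
      ∏ i, X i ^ (if b i = 0 then Function.update a j (a j - 2) i else e i) *
        (1 + X i) ^ (if b i = 0 then e i else Function.update a j (a j - 2) i) := by
  unfold pointTransform
  rw [hF, chartTransform_singleton_prod a e hj, translate_prod_zmod2]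

/-! ## 2. Case (α): a purely odd factor survives — the cleaning deletes nothing -/

omit [DecidableEq σ] in
/-- If some factor is purely odd (`a_k` odd, `e_k` even) then `N(a,e)` has no square monomial:
`N − deletePthPowers 2 N = 0`. [folklore] -/
theorem sub_deletePthPowers_of_purelyOdd (a e : σ → ℕ) {k : σ} (ha : a k % 2 = 1) (he : e k % 2 = 0) :
    (∏ i, X i ^ a i * (1 + X i) ^ e i : MvPolynomial σ (ZMod 2)) -
        deletePthPowers 2 (∏ i, X i ^ a i * (1 + X i) ^ e i) = 0 := by
  classical
  rw [sub_deletePthPowers_prod_univariate]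
  refine Finset.prod_eq_zero (Finset.mem_univ k) ?_
  rw [sub_deletePthPowers_factor, sub_deletePthPowers_residue k _ _ (Nat.mod_lt _ two_pos)
    (Nat.mod_lt _ two_pos), ha, he, if_neg one_ne_zero, if_pos rfl, mul_zero]

/-- **(α)** With a purely odd factor the cleaned transform IS the uncleaned one. [folklore] -/
theorem step_F_of_purelyOdd (s : CState σ (ZMod 2)) (a e : σ → ℕ)
    (hF : s.F = ∏ i, X i ^ a i * (1 + X i) ^ e i) {j : σ} (hj : 2 ≤ a j) (b : σ → ZMod 2) {k : σ}
    (ha : (if b k = 0 then Function.update a j (a j - 2) k else e k) % 2 = 1)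
    (he : (if b k = 0 then e k else Function.update a j (a j - 2) k) % 2 = 0) :
    (step 2 {j} j b s).F =
      ∏ i, X i ^ (if b i = 0 then Function.update a j (a j - 2) i else e i) *
        (1 + X i) ^ (if b i = 0 then e i else Function.update a j (a j - 2) i) := by
  change deletePthPowers 2 (pointTransform 2 {j} j b s) = _
  rw [pointTransform_singleton s a e hF hj b]
  have h := sub_deletePthPowers_of_purelyOdd
    (fun i => if b i = 0 then Function.update a j (a j - 2) i else e i)
    (fun i => if b i = 0 then e i else Function.update a j (a j - 2) i) (k := k) ha he
  exact (sub_eq_zero.mp h).symm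

/-! ## 3. Case (β): every `aᵢ` even — the square part is `N(a, ê)` -/

omit [Fintype σ] [DecidableEq σ] in
/-- `expand 2 (x^n (1+x)^m) = x^{2n} (1+x)^{2m}`. [folklore] -/
theorem expand_factor (i : σ) (n m : ℕ) :
    expand 2 (X i ^ n * (1 + X i) ^ m : MvPolynomial σ (ZMod 2)) = X i ^ (2 * n) * (1 + X i) ^ (2 * m) := by
  rw [map_mul, map_pow, map_pow, expand_X, ← one_add_X_sq, ← pow_mul, ← pow_mul]

omit [DecidableEq σ] in
/-- **(β) square part.** If every `aᵢ` is even then `N(a,e) − deletePthPowers 2 N(a,e) = N(a, ê)`,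
`êᵢ = e′ᵢ − e′ᵢ % 2`. [folklore] -/
theorem sub_deletePthPowers_of_forall_even (a e : σ → ℕ) (ha : ∀ i, a i % 2 = 0) :
    (∏ i, X i ^ a i * (1 + X i) ^ e i : MvPolynomial σ (ZMod 2)) -
        deletePthPowers 2 (∏ i, X i ^ a i * (1 + X i) ^ e i) =
      ∏ i, X i ^ a i * (1 + X i) ^ (e i - e i % 2) := by
  classical
  rw [sub_deletePthPowers_prod_univariate]
  refine Finset.prod_congr rfl fun i _ => ?_
  rw [sub_deletePthPowers_factor, sub_deletePthPowers_residue i _ _ (Nat.mod_lt _ two_pos)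
    (Nat.mod_lt _ two_pos), ha i, if_pos rfl, mul_one, expand_factor]
  congr 1
  · rw [Nat.two_mul_div_two_of_even (Nat.even_iff.mpr (ha i))]
  · congr 1
    have := Nat.div_add_mod (e i) 2
    omega

/-- **(β)** If every exponent `a′ᵢ` of the transform is even, the cleaned transform is `N(a′,e′) − N(a′,ê)`. [folklore] -/
theorem step_F_of_forall_even (s : CState σ (ZMod 2)) (a e : σ → ℕ)
    (hF : s.F = ∏ i, X i ^ a i * (1 + X i) ^ e i) {j : σ} (hj : 2 ≤ a j) (b : σ → ZMod 2)
    (ha : ∀ i, (if b i = 0 then Function.update a j (a j - 2) i else e i) % 2 = 0) :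
    (step 2 {j} j b s).F =
      (∏ i, X i ^ (if b i = 0 then Function.update a j (a j - 2) i else e i) *
          (1 + X i) ^ (if b i = 0 then e i else Function.update a j (a j - 2) i)) -
        ∏ i, X i ^ (if b i = 0 then Function.update a j (a j - 2) i else e i) *
          (1 + X i) ^ ((if b i = 0 then e i else Function.update a j (a j - 2) i) -
            (if b i = 0 then e i else Function.update a j (a j - 2) i) % 2) := by
  change deletePthPowers 2 (pointTransform 2 {j} j b s) = _
  rw [pointTransform_singleton s a e hF hj b]
  have h := sub_deletePthPowers_of_forall_even
    (fun i => if b i = 0 then Function.update a j (a j - 2) i else e i)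
    (fun i => if b i = 0 then e i else Function.update a j (a j - 2) i) ha
  rw [← h, sub_sub_cancel]

omit [DecidableEq σ] in
/-- **The L-factorisation**: `N(a,e) − N(a,ê) = N(a,ê) · (∏_{eᵢ odd} (1+xᵢ) − 1)`. [folklore] -/
theorem prod_sub_eq_mul_L (a e : σ → ℕ) :
    (∏ i, X i ^ a i * (1 + X i) ^ e i : MvPolynomial σ (ZMod 2)) -
        ∏ i, X i ^ a i * (1 + X i) ^ (e i - e i % 2) =
      (∏ i, X i ^ a i * (1 + X i) ^ (e i - e i % 2)) *
        ((∏ i ∈ Finset.univ.filter (fun i => e i % 2 = 1), (1 + X i : MvPolynomial σ (ZMod 2))) - 1) := by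
  classical
  have hsplit : (∏ i, X i ^ a i * (1 + X i) ^ e i : MvPolynomial σ (ZMod 2)) =
      (∏ i, X i ^ a i * (1 + X i) ^ (e i - e i % 2)) * ∏ i, (1 + X i : MvPolynomial σ (ZMod 2)) ^ (e i % 2) := by
    rw [← Finset.prod_mul_distrib]
    refine Finset.prod_congr rfl fun i _ => ?_
    rw [mul_assoc, ← pow_add, Nat.sub_add_cancel (Nat.mod_le _ _)]
  have hodd : (∏ i, (1 + X i : MvPolynomial σ (ZMod 2)) ^ (e i % 2)) =
      ∏ i ∈ Finset.univ.filter (fun i => e i % 2 = 1), (1 + X i : MvPolynomial σ (ZMod 2)) := by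
    rw [Finset.prod_filter]
    refine Finset.prod_congr rfl fun i _ => ?_
    have h2 := Nat.mod_two_eq_zero_or_one (e i)
    rcases h2 with h0 | h1
    · rw [h0, pow_zero, if_neg (by omega)]
    · rw [h1, pow_one, if_pos rfl]
  rw [hsplit, hodd]
  ring

end PureLeafNF

end Summit.ResolutionOfSingularities.ResolutionOfSingularities.Theorems.PIDim4

end
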